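import Summits.AtomisticToContinuum.BoseEinsteinCondensation.Theorems.BECCellInformationEnergyPerParticleBound
import Summits.AtomisticToContinuum.BoseEinsteinCondensation.Theorems.BECCellInformationCoarseChainRule
import Summits.AtomisticToContinuum.BoseEinsteinCondensation.Theorems.BECCellInformationOneBodyEntropyBoundFreeEnergyBound
import Summits.AtomisticToContinuum.BoseEinsteinCondensation.Theorems.BECCellInformationOneBodyEntropyBoundCellChainRule
import Summits.AtomisticToContinuum.BoseEinsteinCondensation.Theorems.BECCellInformationOneBodyEntropyBoundCoarsePosCore
import Summits.AtomisticToContinuum.BoseEinsteinCondensation.Theorems.BECCellInformationOneBodyEntropyBoundWithinCellFisherLSI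

/-!
# Crux `OneBodyEntropyBound` (stmt-AtomisticToContinuum-13440) — PARTIAL RESULT of line `registered`:
# the one-body profile entropy bound for every pair potential with an a.e.-positive core or a.e. zero

Support file (`--supports stmt-AtomisticToContinuum-13440`, lead c1). `oneBodyEntropyBound_of_aeCore_or_aeZero`: for every
repulsive finite-range `v` that EITHER has an a.e.-positive core (`∃ c > 0, r₀ > 0`, `v ≥ c` for a.e. `r ∈ (0, r₀]`: hard and
soft spheres, every potential bounded below near the origin) OR vanishes a.e. on `(0, ∞)` (the free gas), the conclusion of
`…Theses.BECCellInformation.OneBodyEntropyBound` holds for `v`: `∃ ρ₀ > 0, ∀ ρ ∈ (0, ρ₀), ∃ C, ∀ᶠ n, ∃ δ > 0`, every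
`δ`-near-minimiser `Ψ ∈ TrialState (n+1) ((n+1)/ρ)^{1/3}` has `KL(P¹ ‖ u_Λ) = ∫_Λ L⁻³ klFun(L³ P¹) ≤ C`. What is NOT covered
(the registered open stub `stub_coarseEssHollow` of `Lines/birth.lean`): essentially-hollow potentials (`v` without an
a.e.-positive core on any `(0, r₀]` and not a.e. zero, e.g. hollow shells `c·1_[r₁,r₂]`, `0 < r₁`).

Assembly of the LANDED stubs `stub_cellChainRule` (exact KL chain rule over the cell tiling), `stub_withinCellFisherLSI`
(cube LSI + Fisher convexity: within-cell entropies `≤ 3 + s² T/(n+1)`), `stub_coarsePosCore` (pigeonhole: coarse occupation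
entropy `≤ C` for positive-core `v`) and `stub_freeEnergyBound` (`E₀ ≤ C N/L²` for `v = 0` on `(0,∞)`), exactly as in the
skeleton: `of_coarse` (birth assembly: `ρ₀ := min`, `C := max C₁ 0 + 3 + l²(max K 0 + 1)`, `δ := min δ 1`, `M := ⌈L/l⌉₊`),
`free_case` (`M = 1`: whole-box LSI, `KL ≤ 1 + 3 + C₀ + ρ⁻¹`), and the invisibility of null sets of radii
(`GroundStateRigidity.energy_congr_offNull`, glue in `…PosCoreCells.lean`, namespace `Partial`) to pass from a.e.
hypotheses to the pointwise ones of the stubs.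
-/

noncomputable section

namespace Summit.AtomisticToContinuum.BoseEinsteinCondensation.Cruxes.OneBodyEntropyBound.Birth

open MeasureTheory Filter
open scoped ENNReal

namespace Partial

open Literature.MathematicalPhysics.QuantumManyBody.BoseGas InformationTheory
open Summit.AtomisticToContinuum.BoseEinsteinCondensation.Theorems

variable {n : ℕ} {L : ℝ}

/-- The mass of the one-body law in any set is at most one. [folklore] -/
theorem setIntegral_oneBody_le_one (Ψ : TrialState (n + 1) L) (t : Set Space) :
    ∫ x in t, ∫ Y : Config n, ‖Ψ.ψ (Matrix.vecCons x Y)‖ ^ 2 ≤ 1 := by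
  rw [← WithinCell.integral_marginal Ψ]
  exact setIntegral_le_integral (CoarseChainRule.integrable_integral_normSq_vecCons Ψ)
    (ae_of_all _ fun x => integral_nonneg fun Y => sq_nonneg _)

/-- `klFun t ≤ 1` on `[0, 1]` (`t log t ≤ 0` there). [folklore] -/
theorem klFun_le_one {t : ℝ} (h0 : 0 ≤ t) (h1 : t ≤ 1) : klFun t ≤ 1 := by
  rw [klFun_apply]
  have : t * Real.log t ≤ 0 := mul_nonpos_of_nonneg_of_nonpos h0 (Real.log_nonpos h0 h1)
  linarith

/-- **From a coarse occupation-entropy bound to the crux, for a fixed admissible `v`.** This is birth.lean's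
assembly: `ρ₀ := min ρ_coarse ρ_E` (`ρ_E`, `K` from the PROVED route item `EnergyPerParticleBound`),
`C := max C₁ 0 + (3 + l² (max K 0 + 1))`, eventually in `n`, `δ := min δ_coarse 1`, `M := ⌈L/l⌉₊ ≥ 1`,
total `≤` coarse `+` fine (chain rule) `≤ C₁ + 3 + (L/M)² T/(n+1)`, `L/M ≤ l`, `T ≤ energy ≤ E₀ + 1 ≤ K(n+1) + 1`. -/
theorem of_coarse (v : ℝ → ENNReal) (hv : IsRepulsiveFiniteRange v)
    (hcoarse : ∃ ρ₀ : ℝ, 0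
      < ρ₀ ∧ ∀ ρ : ℝ, 0 < ρ → ρ < ρ₀ → ∃ l : ℝ, 0 < l ∧ ∃ C : ℝ, ∀ᶠ n : ℕ in Filter.atTop, ∃ δ :
      ENNReal, 0 < δ ∧ ∀ Ψ : Literature.MathematicalPhysics.QuantumManyBody.BoseGas.TrialState (n +
      1) (Literature.MathematicalPhysics.QuantumManyBody.BoseGas.sideLength ρ (n + 1)),
      Literature.MathematicalPhysics.QuantumManyBody.BoseGas.energy v Ψ ≤
      Literature.MathematicalPhysics.QuantumManyBody.BoseGas.groundStateEnergy v (n + 1)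
      (Literature.MathematicalPhysics.QuantumManyBody.BoseGas.sideLength ρ (n + 1)) + δ →
      ENNReal.ofReal (∑ k : Fin 3 → Fin
      ⌈Literature.MathematicalPhysics.QuantumManyBody.BoseGas.sideLength ρ (n + 1) / l⌉₊,
      ((⌈Literature.MathematicalPhysics.QuantumManyBody.BoseGas.sideLength ρ (n + 1) / l⌉₊ : ℝ) ^
      3)⁻¹ * InformationTheory.klFun
      ((⌈Literature.MathematicalPhysics.QuantumManyBody.BoseGas.sideLength ρ (n + 1) / l⌉₊ : ℝ) ^ 3
      * (∫ x in {y : EuclideanSpace ℝ (Fin 3) | ∀ j, y j ∈ Set.Ico (((k j : ℕ) : ℝ) *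
      ((Literature.MathematicalPhysics.QuantumManyBody.BoseGas.sideLength ρ (n + 1)) /
      (⌈Literature.MathematicalPhysics.QuantumManyBody.BoseGas.sideLength ρ (n + 1) / l⌉₊ : ℝ)))
      ((((k j : ℕ) : ℝ) + 1) * ((Literature.MathematicalPhysics.QuantumManyBody.BoseGas.sideLength
      ρ (n + 1)) / (⌈Literature.MathematicalPhysics.QuantumManyBody.BoseGas.sideLength ρ (n + 1) /
      l⌉₊ : ℝ)))}, ∫ Y' : Literature.MathematicalPhysics.QuantumManyBody.BoseGas.Config n, ‖Ψ.ψ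
      (Matrix.vecCons x Y')‖ ^ 2))) ≤ ENNReal.ofReal C) :
    ∃ ρ₀ : ℝ, 0 < ρ₀ ∧ ∀ ρ : ℝ, 0 < ρ → ρ < ρ₀ → ∃ C : ℝ,
      ∀ᶠ n : ℕ in Filter.atTop, ∃ δ : ENNReal, 0 < δ ∧ ∀ Ψ :
      Literature.MathematicalPhysics.QuantumManyBody.BoseGas.TrialState (n + 1)
      (Literature.MathematicalPhysics.QuantumManyBody.BoseGas.sideLength ρ (n + 1)),
      Literature.MathematicalPhysics.QuantumManyBody.BoseGas.energy v Ψ ≤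
      Literature.MathematicalPhysics.QuantumManyBody.BoseGas.groundStateEnergy v (n + 1)
      (Literature.MathematicalPhysics.QuantumManyBody.BoseGas.sideLength ρ (n + 1)) + δ → ∫⁻ x in
      Literature.MathematicalPhysics.QuantumManyBody.BoseGas.box
      (Literature.MathematicalPhysics.QuantumManyBody.BoseGas.sideLength ρ (n + 1)), ENNReal.ofReal
      ((Literature.MathematicalPhysics.QuantumManyBody.BoseGas.sideLength ρ (n + 1) ^ 3)⁻¹ *
      InformationTheory.klFun (Literature.MathematicalPhysics.QuantumManyBody.BoseGas.sideLength ρ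
      (n + 1) ^ 3 * (∫ Y' : Literature.MathematicalPhysics.QuantumManyBody.BoseGas.Config n, ‖Ψ.ψ
      (Matrix.vecCons x Y')‖ ^ 2))) ≤ ENNReal.ofReal C := by
  obtain ⟨ρ₁, hρ₁, h1⟩ := hcoarse
  obtain ⟨ρ₂, hρ₂, h2⟩ :=
    Summit.AtomisticToContinuum.BoseEinsteinCondensation.Theorems.energyPerParticleBound_proof v hv
  refine ⟨min ρ₁ ρ₂, lt_min hρ₁ hρ₂, fun ρ hρ hρlt => ?_⟩
  obtain ⟨l, hl, C₁, hC₁⟩ := h1 ρ hρ (hρlt.trans_le (min_le_left _ _))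
  obtain ⟨K, hK⟩ := h2 ρ hρ (hρlt.trans_le (min_le_right _ _))
  refine ⟨max C₁ 0 + (3 + l ^ 2 * (max K 0 + 1)), ?_⟩
  have hK' : ∀ᶠ n : ℕ in atTop, groundStateEnergy v (n + 1) (sideLength ρ (n + 1)) ≤
      ENNReal.ofReal (K * ((n + 1 : ℕ) : ℝ)) := (tendsto_add_atTop_nat 1).eventually hK
  filter_upwards [hC₁, hK'] with n hCn hKn
  obtain ⟨δ, hδ, hΨ⟩ := hCn
  set L := sideLength ρ (n + 1) with hLdef
  have hL : 0 < L := Real.rpow_pos_of_pos (div_pos (by exact_mod_cast Nat.succ_pos n) hρ) _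
  set M := ⌈L / l⌉₊ with hMdef
  have hM : 1 ≤ M := Nat.one_le_iff_ne_zero.2 (Nat.ceil_pos.2 (div_pos hL hl)).ne'
  have hMpos : (0 : ℝ) < M := by exact_mod_cast hM
  have hsl : L / M ≤ l := by
    rw [div_le_iff₀ hMpos]
    have h := Nat.le_ceil (L / l)
    rw [div_le_iff₀ hl] at h
    linarith
  have hsl2 : (L / M) ^ 2 ≤ l ^ 2 := pow_le_pow_left₀ (div_nonneg hL.le hMpos.le) hsl 2
  refine ⟨min δ 1, lt_min hδ one_pos, fun Ψ hΨE => ?_⟩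
  -- the three stubs at this state
  have hΨδ : energy v Ψ ≤ groundStateEnergy v (n + 1) L + δ :=
    hΨE.trans (add_le_add le_rfl (min_le_left _ _))
  have hco := hΨ Ψ hΨδ
  have hch := stub_cellChainRule n L hL M hM Ψ
  have hwi := stub_withinCellFisherLSI n L hL M hM Ψ
  -- kinetic energy per particle of a near-minimiser
  have hkin : (∫⁻ X, kineticDensity Ψ.ψ X) / ((n + 1 : ℕ) : ℝ≥0∞) ≤ ENNReal.ofReal (max K 0) + 1 := by
    apply ENNReal.div_le_of_le_mul
    calc ∫⁻ X, kineticDensity Ψ.ψ X ≤ energy v Ψ := lintegral_mono fun X => le_self_add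
      _ ≤ groundStateEnergy v (n + 1) L + min δ 1 := hΨE
      _ ≤ ENNReal.ofReal (K * ((n + 1 : ℕ) : ℝ)) + 1 := add_le_add hKn (min_le_right _ _)
      _ ≤ ENNReal.ofReal (max K 0 * ((n + 1 : ℕ) : ℝ)) + ((n + 1 : ℕ) : ℝ≥0∞) * 1 := by
          gcongr
          · exact le_max_left _ _
          · rw [mul_one]; exact_mod_cast Nat.succ_pos n
      _ = (ENNReal.ofReal (max K 0) + 1) * ((n + 1 : ℕ) : ℝ≥0∞) := by
          rw [ENNReal.ofReal_mul (le_max_right _ _), ENNReal.ofReal_natCast]; ring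
  -- the constant
  have hK0 : (0 : ℝ) ≤ max K 0 + 1 := add_nonneg (le_max_right _ _) zero_le_one
  have hlK : (0 : ℝ) ≤ l ^ 2 * (max K 0 + 1) := mul_nonneg (sq_nonneg _) hK0
  have h3lK : (0 : ℝ) ≤ 3 + l ^ 2 * (max K 0 + 1) := add_nonneg zero_le_three hlK
  have hCeq : ENNReal.ofReal (max C₁ 0 + (3 + l ^ 2 * (max K 0 + 1))) =
      ENNReal.ofReal (max C₁ 0) + (3 + ENNReal.ofReal (l ^ 2) * (ENNReal.ofReal (max K 0) + 1)) := by
    rw [ENNReal.ofReal_add (le_max_right C₁ 0) h3lK, ENNReal.ofReal_add zero_le_three hlK,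
      ENNReal.ofReal_mul (sq_nonneg l), ENNReal.ofReal_add (le_max_right K 0) zero_le_one,
      ENNReal.ofReal_one, ENNReal.ofReal_ofNat]
  rw [hCeq]
  refine hch.trans ((add_le_add hco hwi).trans ?_)
  refine add_le_add (ENNReal.ofReal_le_ofReal (le_max_left _ _)) (add_le_add le_rfl ?_)
  exact mul_le_mul' (ENNReal.ofReal_le_ofReal hsl2) hkin

/-- **The free case.** If `v` vanishes on `(0, ∞)`, the crux holds for `v` with `ρ₀ := 1`,
`C := 1 + (3 + (C₀ + ρ⁻¹))`, `δ := 1`: by the chain rule and the within-cell LSI at `M = 1` (one cell = `[0,L)³`),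
`KL ≤ klFun(∫_{[0,L)³} P¹) + 3 + L² T/(n+1) ≤ 1 + 3 + L² (C₀/L² + 1/(n+1)) ≤ 1 + 3 + C₀ + ρ⁻¹`
(`T ≤ energy ≤ E₀ + 1 ≤ C₀(n+1)/L² + 1`, `L² ≤ L³ = (n+1)/ρ` once `L ≥ 1`). -/
theorem free_case (v : ℝ → ENNReal) (hz : ∀ r : ℝ, 0 < r → v r = 0) :
    ∃ ρ₀ : ℝ, 0 < ρ₀ ∧ ∀ ρ : ℝ, 0 < ρ → ρ < ρ₀ → ∃ C : ℝ,
      ∀ᶠ n : ℕ in Filter.atTop, ∃ δ : ENNReal, 0 < δ ∧ ∀ Ψ :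
      Literature.MathematicalPhysics.QuantumManyBody.BoseGas.TrialState (n + 1)
      (Literature.MathematicalPhysics.QuantumManyBody.BoseGas.sideLength ρ (n + 1)),
      Literature.MathematicalPhysics.QuantumManyBody.BoseGas.energy v Ψ ≤
      Literature.MathematicalPhysics.QuantumManyBody.BoseGas.groundStateEnergy v (n + 1)
      (Literature.MathematicalPhysics.QuantumManyBody.BoseGas.sideLength ρ (n + 1)) + δ → ∫⁻ x in
      Literature.MathematicalPhysics.QuantumManyBody.BoseGas.box
      (Literature.MathematicalPhysics.QuantumManyBody.BoseGas.sideLength ρ (n + 1)), ENNReal.ofReal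
      ((Literature.MathematicalPhysics.QuantumManyBody.BoseGas.sideLength ρ (n + 1) ^ 3)⁻¹ *
      InformationTheory.klFun (Literature.MathematicalPhysics.QuantumManyBody.BoseGas.sideLength ρ
      (n + 1) ^ 3 * (∫ Y' : Literature.MathematicalPhysics.QuantumManyBody.BoseGas.Config n, ‖Ψ.ψ
      (Matrix.vecCons x Y')‖ ^ 2))) ≤ ENNReal.ofReal C := by
  obtain ⟨C₀, hC₀, hE⟩ := stub_freeEnergyBound v hz
  refine ⟨1, one_pos, fun ρ hρ _ => ⟨1 + (3 + (C₀ + ρ⁻¹)), ?_⟩⟩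
  filter_upwards [eventually_ge_atTop ⌈ρ⌉₊] with n hn
  set L := sideLength ρ (n + 1) with hLdef
  have hNpos : (0 : ℝ) < ((n + 1 : ℕ) : ℝ) := by exact_mod_cast Nat.succ_pos n
  have hL : 0 < L := Real.rpow_pos_of_pos (div_pos hNpos hρ) _
  have hL3 : L ^ 3 = ((n + 1 : ℕ) : ℝ) / ρ := by
    have h := div_sideLength_pow_three hρ (Nat.succ_pos n)
    rw [← hLdef, div_eq_iff (pow_pos hL 3).ne'] at h
    rw [eq_div_iff hρ.ne', h, mul_comm]
  have hNρ : ρ ≤ ((n + 1 : ℕ) : ℝ) := by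
    have h1 : ρ ≤ (⌈ρ⌉₊ : ℝ) := Nat.le_ceil ρ
    have h2 : ((⌈ρ⌉₊ : ℕ) : ℝ) ≤ (n : ℝ) := by exact_mod_cast hn
    push_cast
    linarith
  have hL1 : 1 ≤ L := by
    by_contra hlt
    have h3 : L ^ 3 < 1 := pow_lt_one₀ hL.le (not_le.1 hlt) (by norm_num)
    rw [hL3, div_lt_one hρ] at h3
    linarith
  have hL2 : L ^ 2 / ((n + 1 : ℕ) : ℝ) ≤ ρ⁻¹ := by
    rw [div_le_iff₀ hNpos]
    calc L ^ 2 ≤ L ^ 3 := pow_le_pow_right₀ hL1 (by norm_num)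
      _ = ρ⁻¹ * ((n + 1 : ℕ) : ℝ) := by rw [hL3]; ring
  refine ⟨1, one_pos, fun Ψ hΨE => ?_⟩
  -- the two analytic stubs at `M = 1`
  have hch := stub_cellChainRule n L hL 1 le_rfl Ψ
  have hwi := stub_withinCellFisherLSI n L hL 1 le_rfl Ψ
  simp only [Nat.cast_one, one_pow, div_one, inv_one, one_mul] at hch hwi
  -- the coarse term at `M = 1` is at most one
  have hco : ENNReal.ofReal (∑ k : Fin 3 → Fin 1, klFun (∫ x in {y : EuclideanSpace ℝ (Fin 3) | ∀ j, y j ∈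
      Set.Ico (((k j : ℕ) : ℝ) * L) ((((k j : ℕ) : ℝ) + 1) * L)},
      ∫ Y' : Config n, ‖Ψ.ψ (Matrix.vecCons x Y')‖ ^ 2)) ≤ 1 := by
    rw [← ENNReal.ofReal_one]
    refine ENNReal.ofReal_le_ofReal ?_
    calc ∑ k : Fin 3 → Fin 1, klFun (∫ x in {y : EuclideanSpace ℝ (Fin 3) | ∀ j, y j ∈
          Set.Ico (((k j : ℕ) : ℝ) * L) ((((k j : ℕ) : ℝ) + 1) * L)},
          ∫ Y' : Config n, ‖Ψ.ψ (Matrix.vecCons x Y')‖ ^ 2)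
        ≤ ∑ _k : Fin 3 → Fin 1, (1 : ℝ) := Finset.sum_le_sum fun k _ =>
          klFun_le_one (integral_nonneg fun x => integral_nonneg fun Y => sq_nonneg _)
            (setIntegral_oneBody_le_one Ψ _)
      _ = 1 := by simp
  -- kinetic energy per particle of a near-minimiser of the free gas
  have hkin : ENNReal.ofReal (L ^ 2) * ((∫⁻ X, kineticDensity Ψ.ψ X) / ((n + 1 : ℕ) : ℝ≥0∞)) ≤
      ENNReal.ofReal C₀ + ENNReal.ofReal ρ⁻¹ := by
    have hT : (∫⁻ X, kineticDensity Ψ.ψ X) / ((n + 1 : ℕ) : ℝ≥0∞) ≤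
        ENNReal.ofReal (C₀ / L ^ 2 + 1 / ((n + 1 : ℕ) : ℝ)) := by
      apply ENNReal.div_le_of_le_mul
      calc ∫⁻ X, kineticDensity Ψ.ψ X ≤ energy v Ψ := lintegral_mono fun X => le_self_add
        _ ≤ groundStateEnergy v (n + 1) L + 1 := hΨE
        _ ≤ ENNReal.ofReal (C₀ / L ^ 2 * ((n + 1 : ℕ) : ℝ)) + 1 := add_le_add (hE (n + 1) L hL) le_rfl
        _ = ENNReal.ofReal (C₀ / L ^ 2 + 1 / ((n + 1 : ℕ) : ℝ)) * ((n + 1 : ℕ) : ℝ≥0∞) := by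
            rw [← ENNReal.ofReal_natCast ((n + 1 : ℕ)), ← ENNReal.ofReal_one,
              ← ENNReal.ofReal_add (by positivity) zero_le_one,
              ← ENNReal.ofReal_mul (by positivity)]
            congr 1
            field_simp
    calc ENNReal.ofReal (L ^ 2) * ((∫⁻ X, kineticDensity Ψ.ψ X) / ((n + 1 : ℕ) : ℝ≥0∞))
        ≤ ENNReal.ofReal (L ^ 2) * ENNReal.ofReal (C₀ / L ^ 2 + 1 / ((n + 1 : ℕ) : ℝ)) :=
          mul_le_mul' le_rfl hT
      _ = ENNReal.ofReal (C₀ + L ^ 2 / ((n + 1 : ℕ) : ℝ)) := by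
          rw [← ENNReal.ofReal_mul (sq_nonneg L)]
          congr 1
          field_simp
      _ ≤ ENNReal.ofReal (C₀ + ρ⁻¹) := ENNReal.ofReal_le_ofReal (by linarith)
      _ = ENNReal.ofReal C₀ + ENNReal.ofReal ρ⁻¹ := ENNReal.ofReal_add hC₀ (inv_nonneg.2 hρ.le)
  -- assemble
  have hCeq : ENNReal.ofReal (1 + (3 + (C₀ + ρ⁻¹))) =
      1 + (3 + (ENNReal.ofReal C₀ + ENNReal.ofReal ρ⁻¹)) := by
    have h1 : (0 : ℝ) ≤ C₀ + ρ⁻¹ := add_nonneg hC₀ (inv_nonneg.2 hρ.le)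
    rw [ENNReal.ofReal_add zero_le_one (by positivity), ENNReal.ofReal_add zero_le_three h1,
      ENNReal.ofReal_add hC₀ (inv_nonneg.2 hρ.le), ENNReal.ofReal_one, ENNReal.ofReal_ofNat]
  rw [hCeq]
  refine hch.trans ((add_le_add hco hwi).trans ?_)
  exact add_le_add le_rfl (add_le_add le_rfl hkin)


end Partial

open Literature.MathematicalPhysics.QuantumManyBody.BoseGas in
/-- **`OneBodyEntropyBound` for potentials with an a.e.-positive core or a.e. zero** (partial result of the line;
the essentially-hollow class is the open registered stub `stub_coarseEssHollow`). [folklore] -/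
theorem oneBodyEntropyBound_of_aeCore_or_aeZero (v : ℝ → ENNReal) (hv : IsRepulsiveFiniteRange v)
    (h : (∃ c : ENNReal, ∃ r₀ : ℝ, 0 < c ∧ 0 < r₀ ∧ ∀ᵐ r : ℝ ∂(MeasureTheory.volume.restrict (Set.Ioc (0 : ℝ) r₀)), c ≤ v r) ∨
      (∀ᵐ r : ℝ ∂(MeasureTheory.volume.restrict (Set.Ioi (0 : ℝ))), v r = 0)) :
    ∃ ρ₀ : ℝ, 0 < ρ₀ ∧ ∀ ρ : ℝ, 0 < ρ → ρ < ρ₀ → ∃ C : ℝ,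
      ∀ᶠ n : ℕ in Filter.atTop, ∃ δ : ENNReal, 0 < δ ∧ ∀ Ψ :
      Literature.MathematicalPhysics.QuantumManyBody.BoseGas.TrialState (n + 1)
      (Literature.MathematicalPhysics.QuantumManyBody.BoseGas.sideLength ρ (n + 1)),
      Literature.MathematicalPhysics.QuantumManyBody.BoseGas.energy v Ψ ≤
      Literature.MathematicalPhysics.QuantumManyBody.BoseGas.groundStateEnergy v (n + 1)
      (Literature.MathematicalPhysics.QuantumManyBody.BoseGas.sideLength ρ (n + 1)) + δ → ∫⁻ x in
      Literature.MathematicalPhysics.QuantumManyBody.BoseGas.box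
      (Literature.MathematicalPhysics.QuantumManyBody.BoseGas.sideLength ρ (n + 1)), ENNReal.ofReal
      ((Literature.MathematicalPhysics.QuantumManyBody.BoseGas.sideLength ρ (n + 1) ^ 3)⁻¹ *
      InformationTheory.klFun (Literature.MathematicalPhysics.QuantumManyBody.BoseGas.sideLength ρ
      (n + 1) ^ 3 * (∫ Y' : Literature.MathematicalPhysics.QuantumManyBody.BoseGas.Config n, ‖Ψ.ψ
      (Matrix.vecCons x Y')‖ ^ 2))) ≤ ENNReal.ofReal C := by
  rcases h with hpc | hz
  · obtain ⟨c, r₀, hc, hr₀, hae⟩ := hpc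
    obtain ⟨v', hv', hcore', S, hS, hS0, hvS⟩ := Partial.exists_posCore_modification hv hae
    exact Partial.of_coarse v hv
      (Partial.coarse_congr_offNull hS hS0 hvS (stub_coarsePosCore v' hv' ⟨c, r₀, hc, hr₀, hcore'⟩))
  · obtain ⟨hz0, S, hS, hS0, hvS⟩ := Partial.zero_modification hv.1 hz
    exact Partial.crux_congr_offNull hS hS0 hvS (Partial.free_case _ hz0)

/-- **Registered form** of `oneBodyEntropyBound_of_aeCore_or_aeZero` (stub `stub_oneBodyEntropyBound_aeCoreOrAeZero` of
stmt-AtomisticToContinuum-13440: the crux for every `v` with an a.e.-positive core or a.e. zero). [folklore] -/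
theorem stub_oneBodyEntropyBound_aeCoreOrAeZero :
    ∀ v : ℝ → ENNReal, Literature.MathematicalPhysics.QuantumManyBody.BoseGas.IsRepulsiveFiniteRange v →
      ((∃ c : ENNReal, ∃ r₀ : ℝ, 0 < c ∧ 0 < r₀ ∧ ∀ᵐ r : ℝ ∂(MeasureTheory.volume.restrict (Set.Ioc (0 : ℝ) r₀)), c ≤ v r) ∨
      (∀ᵐ r : ℝ ∂(MeasureTheory.volume.restrict (Set.Ioi (0 : ℝ))), v r = 0)) →
      ∃ ρ₀ : ℝ, 0 < ρ₀ ∧ ∀ ρ : ℝ, 0 < ρ → ρ < ρ₀ → ∃ C : ℝ,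
      ∀ᶠ n : ℕ in Filter.atTop, ∃ δ : ENNReal, 0 < δ ∧ ∀ Ψ :
      Literature.MathematicalPhysics.QuantumManyBody.BoseGas.TrialState (n + 1)
      (Literature.MathematicalPhysics.QuantumManyBody.BoseGas.sideLength ρ (n + 1)),
      Literature.MathematicalPhysics.QuantumManyBody.BoseGas.energy v Ψ ≤
      Literature.MathematicalPhysics.QuantumManyBody.BoseGas.groundStateEnergy v (n + 1)
      (Literature.MathematicalPhysics.QuantumManyBody.BoseGas.sideLength ρ (n + 1)) + δ → ∫⁻ x in
      Literature.MathematicalPhysics.QuantumManyBody.BoseGas.box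
      (Literature.MathematicalPhysics.QuantumManyBody.BoseGas.sideLength ρ (n + 1)), ENNReal.ofReal
      ((Literature.MathematicalPhysics.QuantumManyBody.BoseGas.sideLength ρ (n + 1) ^ 3)⁻¹ *
      InformationTheory.klFun (Literature.MathematicalPhysics.QuantumManyBody.BoseGas.sideLength ρ
      (n + 1) ^ 3 * (∫ Y' : Literature.MathematicalPhysics.QuantumManyBody.BoseGas.Config n, ‖Ψ.ψ
      (Matrix.vecCons x Y')‖ ^ 2))) ≤ ENNReal.ofReal C :=
  fun v hv h => oneBodyEntropyBound_of_aeCore_or_aeZero v hv h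

end Summit.AtomisticToContinuum.BoseEinsteinCondensation.Cruxes.OneBodyEntropyBound.Birth

end
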